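import Literature.MathematicalPhysics.QuantumFieldTheory.LatticeGaugeProofs
import HarnessLib

/-!
# Route `LangevinControlUV`, crux `FemtoCurvatureTwoPointC` (stmt-QuantumFields-16204), line `birth` —
# skew two-sided translations preserve product Haar (core of torus tree-gauge fixing)

Registered wave-3 sub-goal `map_pi_haar_twoSided_eq` (`--supports stmt-QuantumFields-16204`),
proved verbatim.

**Statement.** Let `G` be a compact second-countable group with Haar probability measure
`σ = haarProbability G`, `ι` a finite index type and `s ⊆ ι`. Let `l r : G^ι → G^ι` be
(coordinatewise measurable) maps which depend on a configuration `U` only through its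
coordinates INSIDE `s`. Then the push-forward of `σ^{⊗ι}` under

  `U ↦ (l(U)_i · U_i · r(U)_i)_{i ∉ s}`

is `σ^{⊗ {i // i ∉ s}}`.

**Why.** Tree-gauge fixing on the torus sends a configuration `U : Edge → G` to `U^{H(U)}` where
the gauge function `H(U, x)` (comb holonomy) depends only on the tree coordinates `s`; off the
tree, `(U^H)(e) = H(U, x) · U(e) · H(U, y)⁻¹` is a two-sided translation of `U e` by elements
depending only on `U|_s`. This lemma says the law of the off-tree family is product Haar, which
turns the torus partition function into an integral over `G^{#off-tree edges}` (the torus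
free-energy sandwich ⇒ uniform doubling ⇒ the crux's variance-ceiling stub).

**Proof** (`map_pi_haar_twoSided_eq_of_pred`, the same statement for a decidable predicate `p`
in place of `· ∈ s`). Split `G^ι ≅ G^{p} × G^{¬p}` (`MeasurableEquiv.piEquivPiSubtypeProd`, which
carries `σ^{⊗ι}` to `σ^{⊗p} ⊗ σ^{⊗¬p}`, Mathlib `measurePreserving_piEquivPiSubtypeProd`).
Through it the map is `(a, b) ↦ Φ_a(b)` with `Φ_a(b)_i = c(a)_i · b_i · d(a)_i`, where
`c(a) = l(a ⊔ 1)`, `d(a) = r(a ⊔ 1)` only see the inside coordinates (dependence hypotheses).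
For fixed `a`, `Φ_a` is a product of two-sided translations, each preserving `σ` (compact groups
are unimodular: `haarProbability.instIsMulRightInvariant`), hence preserves `σ^{⊗¬p}`
(`measurePreserving_pi`); so the skew product `(a, b) ↦ (a, Φ_a b)` preserves
`σ^{⊗p} ⊗ σ^{⊗¬p}` (`MeasurePreserving.skew_product`), and projecting to the second factor of a
product with a probability first factor gives `σ^{⊗¬p}` (`measurePreserving_snd`).

Everything here is proved from Mathlib and the tree (no named facts, no new definitions).
-/

set_option autoImplicit false

noncomputable section

open MeasureTheory
open Literature.MathematicalPhysics.QuantumFieldTheory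

namespace Summit.QuantumFields.YangMills.Theorems.FemtoCurvatureTwoPointC.TorusGauge

section Pred

variable {G : Type*} [Group G] [TopologicalSpace G] [IsTopologicalGroup G] [CompactSpace G]
  [MeasurableSpace G] [BorelSpace G]

/-- A product of two-sided translations `b ↦ (c_i · b_i · d_i)_i` preserves the product of Haar
probability measures of a compact group over a finite index type: factorwise, left invariance
and right invariance (compact groups are unimodular, `haarProbability.instIsMulRightInvariant`),
assembled by `measurePreserving_pi`. -/
theorem measurePreserving_pi_mul_mul {κ : Type*} [Fintype κ] (c d : κ → G) :
    MeasurePreserving (fun b : κ → G => fun i => c i * b i * d i)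
      (Measure.pi fun _ : κ => haarProbability G) (Measure.pi fun _ : κ => haarProbability G) :=
  measurePreserving_pi (f := fun (i : κ) (x : G) => c i * x * d i)
    (fun _ : κ => haarProbability G) (fun _ : κ => haarProbability G)
    fun i => (measurePreserving_mul_left (haarProbability G) (c i)).mul_right
      (haarProbability G) (d i)

variable [SecondCountableTopology G]

/-- **Skew product Haar lemma, predicate form.** For a decidable predicate `p` on a finite index
type: multiplying every coordinate with `¬p i` on both sides by group elements that depend
measurably on the configuration, but only through its coordinates with `p i`, pushes the product
Haar probability measure on `G^ι` forward to the product Haar probability measure on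
`G^{i // ¬p i}`. -/
theorem map_pi_haar_twoSided_eq_of_pred {ι : Type*} [Fintype ι] (p : ι → Prop)
    [DecidablePred p] (l r : (ι → G) → ι → G)
    (hl : ∀ i, Measurable fun U : ι → G => l U i) (hr : ∀ i, Measurable fun U : ι → G => r U i)
    (hls : ∀ U V : ι → G, (∀ i, p i → U i = V i) → l U = l V)
    (hrs : ∀ U V : ι → G, (∀ i, p i → U i = V i) → r U = r V) :
    (Measure.pi fun _ : ι => haarProbability G).map
        (fun U : ι → G => fun i : {i // ¬p i} => l U i * U i * r U i) =
      Measure.pi fun _ : {i // ¬p i} => haarProbability G := by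
  -- the two halves of the product measure: coordinates inside `p` and outside `p`
  set π₁ : Measure ({i // p i} → G) := Measure.pi fun _ : {i // p i} => haarProbability G
    with hπ₁
  set π₂ : Measure ({i // ¬p i} → G) := Measure.pi fun _ : {i // ¬p i} => haarProbability G
    with hπ₂
  -- the splitting `G^ι ≃ᵐ G^p × G^{¬p}` carries product Haar to the product of product Haars
  set e := MeasurableEquiv.piEquivPiSubtypeProd (fun _ : ι => G) p with he_def
  have he : MeasurePreserving e (Measure.pi fun _ : ι => haarProbability G) (π₁.prod π₂) :=
    measurePreserving_piEquivPiSubtypeProd (fun _ : ι => haarProbability G) p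
  have he_symm_apply : ∀ (z : ({i // p i} → G) × ({i // ¬p i} → G)) (i : ι),
      e.symm z i = if hi : p i then z.1 ⟨i, hi⟩ else z.2 ⟨i, hi⟩ := fun z i => rfl
  -- the translating elements, as functions of the inside coordinates alone
  set c : ({i // p i} → G) → ι → G := fun a => l (e.symm (a, 1)) with hc
  set d : ({i // p i} → G) → ι → G := fun a => r (e.symm (a, 1)) with hd
  -- the fibre maps: products of two-sided translations
  set Φ : ({i // p i} → G) → ({i // ¬p i} → G) → ({i // ¬p i} → G) :=
    fun a b i => c a i * b i * d a i with hΦ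
  have hΦa : ∀ a, MeasurePreserving (Φ a) π₂ π₂ := fun a =>
    measurePreserving_pi_mul_mul (fun i : {i // ¬p i} => c a i) (fun i : {i // ¬p i} => d a i)
  have hΦm : Measurable (Function.uncurry Φ) := by
    refine measurable_pi_lambda _ fun i => ?_
    have h1 : Measurable fun z : ({i // p i} → G) × ({i // ¬p i} → G) => e.symm (z.1, 1) :=
      e.symm.measurable.comp (measurable_fst.prodMk measurable_const)
    exact (((hl i).comp h1).mul ((measurable_pi_apply i).comp measurable_snd)).mul
      ((hr i).comp h1)
  -- the skew product `(a, b) ↦ (a, Φ_a b)` preserves `π₁ ⊗ π₂`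
  have hskew : MeasurePreserving
      (fun z : ({i // p i} → G) × ({i // ¬p i} → G) => (id z.1, Φ z.1 z.2))
      (π₁.prod π₂) (π₁.prod π₂) :=
    (MeasurePreserving.id π₁).skew_product hΦm (ae_of_all _ fun a => (hΦa a).map_eq)
  -- projecting away the probability measure `π₁`
  have hsnd : MeasurePreserving
      (Prod.snd : ({i // p i} → G) × ({i // ¬p i} → G) → ({i // ¬p i} → G))
      (π₁.prod π₂) π₂ := measurePreserving_snd
  -- the map of the statement is the composite `Prod.snd ∘ skew ∘ e` (dependence hypotheses)
  have hF : (fun U : ι → G => fun i : {i // ¬p i} => l U i * U i * r U i) =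
      Prod.snd ∘ ((fun z : ({i // p i} → G) × ({i // ¬p i} → G) => (id z.1, Φ z.1 z.2)) ∘ e) := by
    funext U
    have hU : ∀ i, p i → U i = e.symm ((e U).1, 1) i := by
      intro i hi
      rw [he_symm_apply, dif_pos hi]
      rfl
    have hlU : l U = c (e U).1 := hls _ _ hU
    have hrU : r U = d (e U).1 := hrs _ _ hU
    funext i
    simp only [Function.comp_apply]
    rw [hlU, hrU]
    rfl
  rw [hF]
  exact (hsnd.comp (hskew.comp he)).map_eq

end Pred

/-- **Skew product Haar lemma.** On the product of Haar probability measures over a finite index type `ι`, multiply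
every coordinate OUTSIDE `s` on the left and on the right by group elements that depend measurably on the configuration
but only through its coordinates INSIDE `s`; then the law of the resulting family of outside coordinates is again
product Haar. (Each fibre map is a product of two-sided translations, which preserve Haar on a compact group; integrate
over the `s`-coordinates: `map_pi_haar_twoSided_eq_of_pred` with `p = (· ∈ s)`.) -/
theorem map_pi_haar_twoSided_eq :
    ∀ {ι : Type} [Fintype ι] [DecidableEq ι]
      {G : Type} [Group G] [TopologicalSpace G] [IsTopologicalGroup G] [CompactSpace G]
      [MeasurableSpace G] [BorelSpace G] [SecondCountableTopology G]
      (s : Finset ι) (l r : (ι → G) → ι → G),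
      (∀ i, Measurable fun U : ι → G => l U i) → (∀ i, Measurable fun U : ι → G => r U i) →
      (∀ U V : ι → G, (∀ i ∈ s, U i = V i) → l U = l V) →
      (∀ U V : ι → G, (∀ i ∈ s, U i = V i) → r U = r V) →
      (Measure.pi fun _ : ι => haarProbability G).map
          (fun U : ι → G => fun i : {i // i ∉ s} => l U i * U i * r U i) =
        Measure.pi fun _ : {i // i ∉ s} => haarProbability G :=
  fun s l r hl hr hls hrs => map_pi_haar_twoSided_eq_of_pred (fun i => i ∈ s) l r hl hr hls hrs

end Summit.QuantumFields.YangMills.Theorems.FemtoCurvatureTwoPointC.TorusGauge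

end
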